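import Literature.Topology.PlaneTopology.AnnulusArcs
import Literature.Probability.RandomPlanarGeometry.PlanarDomains
import Mathlib.Analysis.SpecialFunctions.Trigonometric.Arctan
import HarnessLib

/-!
# Routes outside a Jordan domain with prescribed feet
(line `fk-anchor-transfer`, crux `IsingBoundaryRatio`, stmt-CriticalPhenomena-10650; helper file of the stub
`windowRectPresentation_holds`)

Let `H` be a homeomorphism of `ℂ` mapping `closure D` onto the closed unit disc and nothing else into it
(`…WindowRectChart`). In the disc picture a ROUTE between two points of the unit circle at angles `α, β`
runs radially out to radius `R > 1`, along the circle of radius `R`, and radially back in; pulled back by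
`H⁻¹` it is a path outside `closure D` except for its two feet on `∂D`. Two routes at radii `2` and
`R' ∉ {2}` whose radial angles avoid each other's arcs are disjoint (`disjoint_route`). Given four feet whose
angles are UNLINKED on the circle (the second pair on one side of the first, or strictly inside, or
straddling it through the angle `0`), this produces two disjoint outside paths joining the two pairs
(`exists_outside_paths`), with angles read through `θ(u) = π + 2 arctan u` from real parameters `u`.
[folklore]
-/

noncomputable section

open scoped Real
open Set Metric Complex Literature.Topology.PlaneTopology Literature.Probability.RandomPlanarGeometry

namespace Summit.CriticalPhenomena.SAWScalingLimit.Theorems.IsingBoundaryRatio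

namespace WindowRect

/-! ### Points of the punctured plane in polar form -/

/-- `circleMap 0 R θ = R e^{iθ}` has norm `|R|`. [folklore] -/
theorem norm_circleMap_zero' (R θ : ℝ) : ‖circleMap 0 R θ‖ = |R| := by
  simp [circleMap]

/-- Angles in `(0, 2π)` with the same point on the unit circle are equal. [folklore] -/
theorem angle_eq_of_circleMap_eq {θ θ' : ℝ} (hθ : |θ - θ'| < 2 * π) (h : circleMap 0 1 θ = circleMap 0 1 θ') :
    θ = θ' := by
  simp only [circleMap, one_mul, zero_add, ofReal_one] at h
  obtain ⟨n, hn⟩ := Complex.exp_eq_exp_iff_exists_int.1 h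
  have h1 : (θ : ℂ) = θ' + n * (2 * π) := by
    have := congrArg (fun z => z * (-I)) hn
    simp only [add_mul, mul_assoc, show I * -I = 1 by rw [mul_neg, I_mul_I, neg_neg], mul_one] at this
    simpa using this
  have h2 : θ = θ' + n * (2 * π) := by exact_mod_cast h1
  have h3 : |(n : ℝ)| < 1 := by
    rw [h2, add_sub_cancel_left, abs_mul, abs_of_pos Real.two_pi_pos] at hθ
    nlinarith [Real.pi_pos]
  have h4 : n = 0 := by
    have : |n| < 1 := by exact_mod_cast h3
    rw [abs_lt] at this
    omega
  rw [h2, h4]; simp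

/-- Polar points with positive radii agree only if radii and unit points agree. [folklore] -/
theorem eq_of_smul_circleMap_eq {t t' θ θ' : ℝ} (ht : 0 < t) (ht' : 0 < t')
    (h : circleMap 0 t θ = circleMap 0 t' θ') : t = t' ∧ circleMap 0 1 θ = circleMap 0 1 θ' := by
  have hn : t = t' := by
    have := congrArg norm h
    rwa [norm_circleMap_zero', norm_circleMap_zero', abs_of_pos ht, abs_of_pos ht'] at this
  subst hn
  refine ⟨rfl, ?_⟩
  simp only [circleMap, zero_add, one_mul, ofReal_one] at h ⊢
  exact mul_left_cancel₀ (by exact_mod_cast ht.ne') h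

/-- A point of the radial segment is a polar point with radius in between. [folklore] -/
theorem exists_of_mem_radial {R θ : ℝ} (hR : 1 ≤ R) {z : ℂ} (hz : z ∈ segment ℝ (circleMap 0 1 θ) (circleMap 0 R θ)) :
    ∃ t ∈ Icc 1 R, z = circleMap 0 t θ := by
  rw [segment_eq_image_lineMap] at hz
  obtain ⟨s, ⟨hs0, hs1⟩, rfl⟩ := hz
  refine ⟨(1 - s) * 1 + s * R, ⟨by nlinarith, by nlinarith⟩, ?_⟩
  rw [AffineMap.lineMap_apply_module]
  simp only [circleMap, zero_add, ofReal_one, one_mul, Complex.real_smul]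
  push_cast
  ring

/-- A point of the circular arc is a polar point with angle in between. [folklore] -/
theorem exists_of_mem_arc {R α β : ℝ} {z : ℂ} (hz : z ∈ range (circleArc 0 R α β)) :
    ∃ θ ∈ uIcc α β, z = circleMap 0 R θ := by
  obtain ⟨t, rfl⟩ := hz
  refine ⟨AffineMap.lineMap α β (t : ℝ), ?_, circleArc_apply 0 R α β t⟩
  rw [← segment_eq_uIcc, segment_eq_image_lineMap]
  exact ⟨t, t.2, rfl⟩

/-! ### Routes in the disc picture -/

/-- **The route** at radius `R` from angle `α` to angle `β` (radial out, arc, radial in): its points have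
norm `≥ 1`, with equality only at its two feet. [folklore] -/
theorem route_norm {R α β : ℝ} (hR : 1 < R) {z : ℂ}
    (hz : z ∈ range (((Path.segment (circleMap 0 1 α) (circleMap 0 R α)).trans (circleArc 0 R α β)).trans
      (Path.segment (circleMap 0 R β) (circleMap 0 1 β)))) :
    1 ≤ ‖z‖ ∧ (‖z‖ = 1 → z = circleMap 0 1 α ∨ z = circleMap 0 1 β) := by
  simp only [Path.trans_range, Path.range_segment, mem_union] at hz
  rcases hz with (hz | hz) | hz
  · obtain ⟨t, ht, rfl⟩ := exists_of_mem_radial hR.le hz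
    rw [norm_circleMap_zero', abs_of_pos (by linarith [ht.1])]
    refine ⟨ht.1, fun h => Or.inl (by rw [h])⟩
  · obtain ⟨θ, -, rfl⟩ := exists_of_mem_arc hz
    rw [norm_circleMap_zero', abs_of_pos (by linarith)]
    exact ⟨hR.le, fun h => absurd h hR.ne'⟩
  · rw [segment_symm] at hz
    obtain ⟨t, ht, rfl⟩ := exists_of_mem_radial hR.le hz
    rw [norm_circleMap_zero', abs_of_pos (by linarith [ht.1])]
    refine ⟨ht.1, fun h => Or.inr (by rw [h])⟩

/-- **Two routes at radii `2` and `R' ∉ {2}` are disjoint** provided the radial angles differ, the radial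
angles of the second avoid the arc of the first when `R' > 2`, and the radial angles of the first avoid
the arc of the second when `R' < 2`. [folklore] -/
theorem disjoint_route {α₁ β₁ α₂ β₂ R' : ℝ} (hR' : 1 < R') (hR'2 : R' ≠ 2)
    (Hend : circleMap 0 1 α₁ ≠ circleMap 0 1 α₂ ∧ circleMap 0 1 α₁ ≠ circleMap 0 1 β₂ ∧
      circleMap 0 1 β₁ ≠ circleMap 0 1 α₂ ∧ circleMap 0 1 β₁ ≠ circleMap 0 1 β₂)
    (HB : 2 < R' → ∀ θ ∈ uIcc α₁ β₁, circleMap 0 1 θ ≠ circleMap 0 1 α₂ ∧ circleMap 0 1 θ ≠ circleMap 0 1 β₂)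
    (HA : R' < 2 → ∀ θ ∈ uIcc α₂ β₂, circleMap 0 1 θ ≠ circleMap 0 1 α₁ ∧ circleMap 0 1 θ ≠ circleMap 0 1 β₁) :
    Disjoint (range (((Path.segment (circleMap 0 1 α₁) (circleMap 0 2 α₁)).trans (circleArc 0 2 α₁ β₁)).trans
        (Path.segment (circleMap 0 2 β₁) (circleMap 0 1 β₁))))
      (range (((Path.segment (circleMap 0 1 α₂) (circleMap 0 R' α₂)).trans (circleArc 0 R' α₂ β₂)).trans
        (Path.segment (circleMap 0 R' β₂) (circleMap 0 1 β₂)))) := by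
  rw [Set.disjoint_left]
  intro z hz1 hz2
  simp only [Path.trans_range, Path.range_segment, mem_union] at hz1 hz2
  have h2 : (1 : ℝ) ≤ 2 := by norm_num
  have P1 : (∃ t ∈ Icc (1 : ℝ) 2, ∃ φ, (φ = α₁ ∨ φ = β₁) ∧ z = circleMap 0 t φ) ∨
      (∃ θ ∈ uIcc α₁ β₁, z = circleMap 0 2 θ) := by
    rcases hz1 with (hz | hz) | hz
    · obtain ⟨t, ht, rfl⟩ := exists_of_mem_radial h2 hz; exact Or.inl ⟨t, ht, α₁, Or.inl rfl, rfl⟩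
    · exact Or.inr (exists_of_mem_arc hz)
    · rw [segment_symm] at hz
      obtain ⟨t, ht, rfl⟩ := exists_of_mem_radial h2 hz; exact Or.inl ⟨t, ht, β₁, Or.inr rfl, rfl⟩
  have P2 : (∃ t ∈ Icc (1 : ℝ) R', ∃ φ, (φ = α₂ ∨ φ = β₂) ∧ z = circleMap 0 t φ) ∨
      (∃ θ ∈ uIcc α₂ β₂, z = circleMap 0 R' θ) := by
    rcases hz2 with (hz | hz) | hz
    · obtain ⟨t, ht, rfl⟩ := exists_of_mem_radial hR'.le hz; exact Or.inl ⟨t, ht, α₂, Or.inl rfl, rfl⟩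
    · exact Or.inr (exists_of_mem_arc hz)
    · rw [segment_symm] at hz
      obtain ⟨t, ht, rfl⟩ := exists_of_mem_radial hR'.le hz; exact Or.inl ⟨t, ht, β₂, Or.inr rfl, rfl⟩
  have hne : ∀ {φ φ'}, (φ = α₁ ∨ φ = β₁) → (φ' = α₂ ∨ φ' = β₂) → circleMap 0 1 φ ≠ circleMap 0 1 φ' := by
    rintro φ φ' (rfl | rfl) (rfl | rfl)
    · exact Hend.1
    · exact Hend.2.1
    · exact Hend.2.2.1
    · exact Hend.2.2.2
  rcases P1 with ⟨t, ht, φ, hφ, rfl⟩ | ⟨θ, hθ, rfl⟩ <;> rcases P2 with ⟨t', ht', φ', hφ', h⟩ | ⟨θ', hθ', h⟩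
  · obtain ⟨-, h'⟩ := eq_of_smul_circleMap_eq (by linarith [ht.1]) (by linarith [ht'.1]) h
    exact hne hφ hφ' h'
  · obtain ⟨ht2, h'⟩ := eq_of_smul_circleMap_eq (by linarith [ht.1]) (by linarith) h
    have hlt : R' < 2 := lt_of_le_of_ne (ht2 ▸ ht.2) hR'2
    rcases hφ with rfl | rfl
    · exact (HA hlt θ' hθ').1 h'.symm
    · exact (HA hlt θ' hθ').2 h'.symm
  · obtain ⟨ht2, h'⟩ := eq_of_smul_circleMap_eq (by norm_num) (by linarith [ht'.1]) h
    have hlt : 2 < R' := lt_of_le_of_ne (ht2 ▸ ht'.2) (Ne.symm hR'2)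
    rcases hφ' with rfl | rfl
    · exact (HB hlt θ hθ).1 h'
    · exact (HB hlt θ hθ).2 h'
  · obtain ⟨h', -⟩ := eq_of_smul_circleMap_eq (by norm_num) (by linarith) h
    exact hR'2 h'.symm

/-! ### Pulling the routes back by the homeomorphism -/

/-- **Assembling the two outside paths** from angles satisfying the hypotheses of `disjoint_route`.
[folklore] -/
theorem exists_outside_paths_of_angles (D : JordanDomain) (H : ℂ ≃ₜ ℂ)
    (hH : ∀ z, z ∈ closure D.carrier ↔ ‖H z‖ ≤ 1) {p₁ q₁ p₂ q₂ : ℂ} {α₁ β₁ α₂ β₂ R' : ℝ} (hR' : 1 < R')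
    (hR'2 : R' ≠ 2) (hp₁ : H p₁ = circleMap 0 1 α₁) (hq₁ : H q₁ = circleMap 0 1 β₁)
    (hp₂ : H p₂ = circleMap 0 1 α₂) (hq₂ : H q₂ = circleMap 0 1 β₂)
    (Hend : circleMap 0 1 α₁ ≠ circleMap 0 1 α₂ ∧ circleMap 0 1 α₁ ≠ circleMap 0 1 β₂ ∧
      circleMap 0 1 β₁ ≠ circleMap 0 1 α₂ ∧ circleMap 0 1 β₁ ≠ circleMap 0 1 β₂)
    (HB : 2 < R' → ∀ θ ∈ uIcc α₁ β₁, circleMap 0 1 θ ≠ circleMap 0 1 α₂ ∧ circleMap 0 1 θ ≠ circleMap 0 1 β₂)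
    (HA : R' < 2 → ∀ θ ∈ uIcc α₂ β₂, circleMap 0 1 θ ≠ circleMap 0 1 α₁ ∧ circleMap 0 1 θ ≠ circleMap 0 1 β₁) :
    ∃ (A : Path p₁ q₁) (B : Path p₂ q₂), Disjoint (range A) (range B) ∧
      (∀ z ∈ range A, z ∉ closure D.carrier ∨ z = p₁ ∨ z = q₁) ∧
      (∀ z ∈ range B, z ∉ closure D.carrier ∨ z = p₂ ∨ z = q₂) := by
  set Aw := ((Path.segment (circleMap 0 1 α₁) (circleMap 0 2 α₁)).trans (circleArc 0 2 α₁ β₁)).trans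
    (Path.segment (circleMap 0 2 β₁) (circleMap 0 1 β₁)) with hAw
  set Bw := ((Path.segment (circleMap 0 1 α₂) (circleMap 0 R' α₂)).trans (circleArc 0 R' α₂ β₂)).trans
    (Path.segment (circleMap 0 R' β₂) (circleMap 0 1 β₂)) with hBw
  have hdis := disjoint_route hR' hR'2 Hend HB HA
  have ep₁ : p₁ = H.symm (circleMap 0 1 α₁) := by rw [← hp₁, H.symm_apply_apply]
  have eq₁ : q₁ = H.symm (circleMap 0 1 β₁) := by rw [← hq₁, H.symm_apply_apply]
  have ep₂ : p₂ = H.symm (circleMap 0 1 α₂) := by rw [← hp₂, H.symm_apply_apply]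
  have eq₂ : q₂ = H.symm (circleMap 0 1 β₂) := by rw [← hq₂, H.symm_apply_apply]
  refine ⟨(Aw.map H.symm.continuous).cast ep₁ eq₁, (Bw.map H.symm.continuous).cast ep₂ eq₂, ?_, ?_, ?_⟩
  · rw [Set.disjoint_left]
    intro z hzA hzB
    rw [Path.cast_coe, Path.map_coe, range_comp] at hzA hzB
    obtain ⟨w, hw, rfl⟩ := hzA
    obtain ⟨w', hw', hww'⟩ := hzB
    rw [H.symm.injective hww'] at hw'
    exact Set.disjoint_left.1 hdis hw hw'
  · intro z hz
    rw [Path.cast_coe, Path.map_coe, range_comp] at hz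
    obtain ⟨w, hw, rfl⟩ := hz
    obtain ⟨h1, h1'⟩ := route_norm (R := 2) (by norm_num) hw
    rcases h1.eq_or_lt with h | h
    · rcases h1' h.symm with rfl | rfl
      · exact Or.inr (Or.inl ep₁.symm)
      · exact Or.inr (Or.inr eq₁.symm)
    · left; rw [hH, H.apply_symm_apply]; exact not_le.2 h
  · intro z hz
    rw [Path.cast_coe, Path.map_coe, range_comp] at hz
    obtain ⟨w, hw, rfl⟩ := hz
    obtain ⟨h1, h1'⟩ := route_norm hR' hw
    rcases h1.eq_or_lt with h | h
    · rcases h1' h.symm with rfl | rfl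
      · exact Or.inr (Or.inl ep₂.symm)
      · exact Or.inr (Or.inr eq₂.symm)
    · left; rw [hH, H.apply_symm_apply]; exact not_le.2 h

/-! ### Angles from real boundary parameters -/

/-- The angle `θ(u) = π + 2 arctan u` lies in `(0, 2π)`. [folklore] -/
theorem angle_mem_Ioo (u : ℝ) : 0 < π + 2 * Real.arctan u ∧ π + 2 * Real.arctan u < 2 * π := by
  have h1 := Real.neg_pi_div_two_lt_arctan u
  have h2 := Real.arctan_lt_pi_div_two u
  constructor <;> linarith

/-- `θ` is strictly increasing. [folklore] -/
theorem angle_lt_angle {u v : ℝ} (h : u < v) : π + 2 * Real.arctan u < π + 2 * Real.arctan v := by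
  have := Real.arctan_strictMono h
  linarith

/-- Distinct angles in `(0, 2π)` give distinct points of the unit circle. [folklore] -/
theorem circleMap_ne_of_ne {a b : ℝ} (ha : 0 < a ∧ a < 2 * π) (hb : 0 < b ∧ b < 2 * π) (hab : a ≠ b) :
    circleMap 0 1 a ≠ circleMap 0 1 b := fun h =>
  hab (angle_eq_of_circleMap_eq (by rw [abs_lt]; constructor <;> linarith [ha.1, ha.2, hb.1, hb.2]) h)

/-- **Two disjoint outside paths joining two unlinked pairs of boundary points.** The feet are read in the
disc picture through `H p = e^{iθ(u_p)}`, `θ(u) = π + 2 arctan u`; "unlinked" means: both parameters of the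
second pair below those of the first, or both above, or both strictly between, or one below and one above.
[folklore] -/
theorem exists_outside_paths (D : JordanDomain) (H : ℂ ≃ₜ ℂ) (hH : ∀ z, z ∈ closure D.carrier ↔ ‖H z‖ ≤ 1)
    {p₁ q₁ p₂ q₂ : ℂ} {u₁ v₁ u₂ v₂ : ℝ}
    (hp₁ : H p₁ = circleMap 0 1 (π + 2 * Real.arctan u₁)) (hq₁ : H q₁ = circleMap 0 1 (π + 2 * Real.arctan v₁))
    (hp₂ : H p₂ = circleMap 0 1 (π + 2 * Real.arctan u₂)) (hq₂ : H q₂ = circleMap 0 1 (π + 2 * Real.arctan v₂))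
    (hunl : (u₂ < min u₁ v₁ ∧ v₂ < min u₁ v₁) ∨ (max u₁ v₁ < u₂ ∧ max u₁ v₁ < v₂) ∨
      (min u₁ v₁ < u₂ ∧ u₂ < max u₁ v₁ ∧ min u₁ v₁ < v₂ ∧ v₂ < max u₁ v₁) ∨
      (u₂ < min u₁ v₁ ∧ max u₁ v₁ < v₂) ∨ (v₂ < min u₁ v₁ ∧ max u₁ v₁ < u₂)) :
    ∃ (A : Path p₁ q₁) (B : Path p₂ q₂), Disjoint (range A) (range B) ∧
      (∀ z ∈ range A, z ∉ closure D.carrier ∨ z = p₁ ∨ z = q₁) ∧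
      (∀ z ∈ range B, z ∉ closure D.carrier ∨ z = p₂ ∨ z = q₂) := by
  -- notation for angles
  have A1 := angle_mem_Ioo u₁; have B1 := angle_mem_Ioo v₁; have A2 := angle_mem_Ioo u₂; have B2 := angle_mem_Ioo v₂
  have hper : ∀ a : ℝ, circleMap 0 1 (a + 2 * π) = circleMap 0 1 a := fun a => periodic_circleMap 0 1 a
  have hper' : ∀ a : ℝ, circleMap 0 1 (a - 2 * π) = circleMap 0 1 a := fun a => by
    rw [← hper (a - 2 * π), sub_add_cancel]
  -- bounds on the arc angles of the first route
  have huIcc : ∀ θ ∈ uIcc (π + 2 * Real.arctan u₁) (π + 2 * Real.arctan v₁),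
      π + 2 * Real.arctan (min u₁ v₁) ≤ θ ∧ θ ≤ π + 2 * Real.arctan (max u₁ v₁) ∧ 0 < θ ∧ θ < 2 * π := by
    intro θ hθ
    have hm1 := Real.arctan_strictMono.monotone (min_le_left u₁ v₁)
    have hm2 := Real.arctan_strictMono.monotone (min_le_right u₁ v₁)
    have hM1 := Real.arctan_strictMono.monotone (le_max_left u₁ v₁)
    have hM2 := Real.arctan_strictMono.monotone (le_max_right u₁ v₁)
    rcases mem_uIcc.1 hθ with ⟨h1, h2⟩ | ⟨h1, h2⟩
    · exact ⟨by linarith, by linarith, by linarith [A1.1], by linarith [B1.2]⟩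
    · exact ⟨by linarith, by linarith, by linarith [B1.1], by linarith [A1.2]⟩
  have hu₁ : u₁ = min u₁ v₁ ∨ u₁ = max u₁ v₁ := by
    rcases le_total u₁ v₁ with h | h
    · exact Or.inl (min_eq_left h).symm
    · exact Or.inr (max_eq_left h).symm
  have hv₁ : v₁ = min u₁ v₁ ∨ v₁ = max u₁ v₁ := by
    rcases le_total u₁ v₁ with h | h
    · exact Or.inr (max_eq_right h).symm
    · exact Or.inl (min_eq_right h).symm
  -- distinct parameters give distinct circle points
  have hne : ∀ (a b : ℝ), a ≠ b → circleMap 0 1 (π + 2 * Real.arctan a) ≠ circleMap 0 1 (π + 2 * Real.arctan b) :=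
    fun a b hab => circleMap_ne_of_ne (angle_mem_Ioo a) (angle_mem_Ioo b)
      (fun h => hab (Real.arctan_injective (by linarith)))
  have hmM : min u₁ v₁ ≤ max u₁ v₁ := min_le_max
  rcases hunl with ⟨hu, hv⟩ | ⟨hu, hv⟩ | ⟨hu, hu', hv, hv'⟩ | ⟨hu, hv⟩ | ⟨hv, hu⟩
  · -- both below: radius 3, direct arc
    refine exists_outside_paths_of_angles D H hH (R' := 3) (by norm_num) (by norm_num) hp₁ hq₁ hp₂ hq₂
      ⟨?_, ?_, ?_, ?_⟩ (fun _ θ hθ => ⟨?_, ?_⟩) (fun h => absurd h (by norm_num))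
    · exact hne u₁ u₂ fun e => by linarith [min_le_left u₁ v₁, le_max_left u₁ v₁]
    · exact hne u₁ v₂ fun e => by linarith [min_le_left u₁ v₁, le_max_left u₁ v₁]
    · exact hne v₁ u₂ fun e => by linarith [min_le_right u₁ v₁, le_max_right u₁ v₁]
    · exact hne v₁ v₂ fun e => by linarith [min_le_right u₁ v₁, le_max_right u₁ v₁]
    · obtain ⟨h1, -, h3, h4⟩ := huIcc θ hθ
      exact circleMap_ne_of_ne ⟨h3, h4⟩ A2 (fun e => by linarith [angle_lt_angle hu])
    · obtain ⟨h1, -, h3, h4⟩ := huIcc θ hθ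
      exact circleMap_ne_of_ne ⟨h3, h4⟩ B2 (fun e => by linarith [angle_lt_angle hv])
  · -- both above
    refine exists_outside_paths_of_angles D H hH (R' := 3) (by norm_num) (by norm_num) hp₁ hq₁ hp₂ hq₂
      ⟨?_, ?_, ?_, ?_⟩ (fun _ θ hθ => ⟨?_, ?_⟩) (fun h => absurd h (by norm_num))
    · exact hne u₁ u₂ fun e => by linarith [min_le_left u₁ v₁, le_max_left u₁ v₁]
    · exact hne u₁ v₂ fun e => by linarith [min_le_left u₁ v₁, le_max_left u₁ v₁]
    · exact hne v₁ u₂ fun e => by linarith [min_le_right u₁ v₁, le_max_right u₁ v₁]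
    · exact hne v₁ v₂ fun e => by linarith [min_le_right u₁ v₁, le_max_right u₁ v₁]
    · obtain ⟨-, h2, h3, h4⟩ := huIcc θ hθ
      exact circleMap_ne_of_ne ⟨h3, h4⟩ A2 (fun e => by linarith [angle_lt_angle hu])
    · obtain ⟨-, h2, h3, h4⟩ := huIcc θ hθ
      exact circleMap_ne_of_ne ⟨h3, h4⟩ B2 (fun e => by linarith [angle_lt_angle hv])
  · -- both strictly inside: radius 3/2
    refine exists_outside_paths_of_angles D H hH (R' := 3 / 2) (by norm_num) (by norm_num) hp₁ hq₁ hp₂ hq₂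
      ⟨?_, ?_, ?_, ?_⟩ (fun h => absurd h (by norm_num)) (fun _ θ hθ => ⟨?_, ?_⟩)
    · exact hne u₁ u₂ fun e => by
        rcases hu₁ with h | h
        · rw [← h] at hu; linarith
        · rw [← h] at hu'; linarith
    · exact hne u₁ v₂ fun e => by
        rcases hu₁ with h | h
        · rw [← h] at hv; linarith
        · rw [← h] at hv'; linarith
    · exact hne v₁ u₂ fun e => by
        rcases hv₁ with h | h
        · rw [← h] at hu; linarith
        · rw [← h] at hu'; linarith
    · exact hne v₁ v₂ fun e => by
        rcases hv₁ with h | h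
        · rw [← h] at hv; linarith
        · rw [← h] at hv'; linarith
    · have hlo := angle_lt_angle hu; have hhi := angle_lt_angle hu'
      have hlo' := angle_lt_angle hv; have hhi' := angle_lt_angle hv'
      have hθb : π + 2 * Real.arctan (min u₁ v₁) < θ ∧ θ < π + 2 * Real.arctan (max u₁ v₁) := by
        rcases mem_uIcc.1 hθ with ⟨h1, h2⟩ | ⟨h1, h2⟩ <;> constructor <;> linarith
      refine circleMap_ne_of_ne ⟨by linarith [(angle_mem_Ioo (min u₁ v₁)).1], by
        linarith [(angle_mem_Ioo (max u₁ v₁)).2]⟩ A1 fun e => ?_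
      rcases hu₁ with h | h <;> rw [h] at e <;> linarith
    · have hlo := angle_lt_angle hu; have hhi := angle_lt_angle hu'
      have hlo' := angle_lt_angle hv; have hhi' := angle_lt_angle hv'
      have hθb : π + 2 * Real.arctan (min u₁ v₁) < θ ∧ θ < π + 2 * Real.arctan (max u₁ v₁) := by
        rcases mem_uIcc.1 hθ with ⟨h1, h2⟩ | ⟨h1, h2⟩ <;> constructor <;> linarith
      refine circleMap_ne_of_ne ⟨by linarith [(angle_mem_Ioo (min u₁ v₁)).1], by
        linarith [(angle_mem_Ioo (max u₁ v₁)).2]⟩ B1 fun e => ?_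
      rcases hv₁ with h | h <;> rw [h] at e <;> linarith
  · -- `u₂` below, `v₂` above: arc the other way, from `θ u₂` down to `θ v₂ - 2π`
    have hq₂' : H q₂ = circleMap 0 1 (π + 2 * Real.arctan v₂ - 2 * π) := by rw [hper', hq₂]
    refine exists_outside_paths_of_angles D H hH (R' := 3) (by norm_num) (by norm_num) hp₁ hq₁ hp₂ hq₂'
      ⟨?_, ?_, ?_, ?_⟩ (fun _ θ hθ => ⟨?_, ?_⟩) (fun h => absurd h (by norm_num))
    · exact hne u₁ u₂ fun e => by linarith [min_le_left u₁ v₁, le_max_left u₁ v₁]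
    · rw [hper']; exact hne u₁ v₂ fun e => by linarith [min_le_left u₁ v₁, le_max_left u₁ v₁]
    · exact hne v₁ u₂ fun e => by linarith [min_le_right u₁ v₁, le_max_right u₁ v₁]
    · rw [hper']; exact hne v₁ v₂ fun e => by linarith [min_le_right u₁ v₁, le_max_right u₁ v₁]
    · obtain ⟨h1, -, h3, h4⟩ := huIcc θ hθ
      exact circleMap_ne_of_ne ⟨h3, h4⟩ A2 (fun e => by linarith [angle_lt_angle hu])
    · rw [hper']
      obtain ⟨-, h2, h3, h4⟩ := huIcc θ hθ
      exact circleMap_ne_of_ne ⟨h3, h4⟩ B2 (fun e => by linarith [angle_lt_angle hv])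
  · -- `v₂` below, `u₂` above: from `θ u₂` up to `θ v₂ + 2π`
    have hq₂' : H q₂ = circleMap 0 1 (π + 2 * Real.arctan v₂ + 2 * π) := by rw [hper, hq₂]
    refine exists_outside_paths_of_angles D H hH (R' := 3) (by norm_num) (by norm_num) hp₁ hq₁ hp₂ hq₂'
      ⟨?_, ?_, ?_, ?_⟩ (fun _ θ hθ => ⟨?_, ?_⟩) (fun h => absurd h (by norm_num))
    · exact hne u₁ u₂ fun e => by linarith [min_le_left u₁ v₁, le_max_left u₁ v₁]
    · rw [hper]; exact hne u₁ v₂ fun e => by linarith [min_le_left u₁ v₁, le_max_left u₁ v₁]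
    · exact hne v₁ u₂ fun e => by linarith [min_le_right u₁ v₁, le_max_right u₁ v₁]
    · rw [hper]; exact hne v₁ v₂ fun e => by linarith [min_le_right u₁ v₁, le_max_right u₁ v₁]
    · obtain ⟨-, h2, h3, h4⟩ := huIcc θ hθ
      exact circleMap_ne_of_ne ⟨h3, h4⟩ A2 (fun e => by linarith [angle_lt_angle hu])
    · rw [hper]
      obtain ⟨h1, -, h3, h4⟩ := huIcc θ hθ
      exact circleMap_ne_of_ne ⟨h3, h4⟩ B2 (fun e => by linarith [angle_lt_angle hv])

end WindowRect

/-- **Distinct angles in `(0, 2π)` give distinct points of the unit circle**, closed form (registered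
sub-goal of stmt-CriticalPhenomena-10650). [folklore] -/
theorem windowRect_circleMap_ne_of_ne : ∀ {a b : ℝ}, (0 < a ∧ a < 2 * Real.pi) → (0 < b ∧ b < 2 * Real.pi) → a ≠ b → circleMap 0 1 a ≠ circleMap 0 1 b :=
  fun ha hb hab => WindowRect.circleMap_ne_of_ne ha hb hab

end Summit.CriticalPhenomena.SAWScalingLimit.Theorems.IsingBoundaryRatio

end
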